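import Literature.Geometry.Kaehler.ComplexTorusWeilJ
import HarnessLib

/-!
# The `-4`-eigenspace of `(1 + J)^*` on `4`-forms of `ℂ⁴`: the Weil classes are of type `(2, 2)`

Companion of `Literature/Geometry/Kaehler/ComplexTorusWeilJ.lean` (the Weil operator
`J = diag(i, i, -i, -i)` on `V = ℂ⁴`, the isogeny `S = 1 + J`, the Weil form
`Ω = dz₀ ∧ dz₁ ∧ dz̄₂ ∧ dz̄₃` with `(1 + J)^*Ω = -4 Ω`). Here the converse is PROVED — the linear
algebra behind C. Voisin, IMRN 2002 no. 20, §3 (pp. 5–6 of arXiv:math/0112247): for a complex torus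
of Weil type `X = Γ_ℂ/(W ⊕ Γ)`, `Γ_ℚ = K⁴`, `K = ℚ[I]`, the `2`-dimensional space of Weil classes
`⋀⁴_K Γ_ℚ ⊂ ⋀⁴ Γ_ℚ = H⁴(X, ℚ)` complexifies to `⋀⁴ ℂ⁴_i ⊕ ⋀⁴ ℂ⁴_{-i}`, and
"`⋀⁴ ℂ⁴_i = ⋀² W_i ⊗ ⋀² W̄_{-i}` is contained in `⋀² W ⊗ ⋀² W̄`, that is in `H^{2,2}(X)`".
In the coordinates of `ComplexTorusWeilJ` (`H⁴_dR(X; ℂ) = Alt⁴_ℝ(ℂ⁴; ℂ)` by invariant forms,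
Lange–Birkenhake Prop. 1.1.20, tree `ComplexTorus.cconstClassEquiv`; `1 + I` acting by
`γ ↦ γ ∘ S`), with no choice of lattice involved:

* `Weil.apply_S_S_S_S`, `Weil.compContinuousLinearMap_S_four`: **`S⁴ = -4`, so `((1+J)^*)⁴ = 256`
  on `4`-forms** — the minimal polynomial `(t + 4)(t - 4)(t² + 16) = t⁴ - 256` of `(1 + I)^*` on
  `H⁴` (eigenvalues `(1+i)^a (1-i)^{4-a}`), with no eigenspace analysis;
* `Weil.exists_eq_Omega_of_apply_S`: **if `γ ∘ S = -4 γ` then `γ = a Ω + b Ω̄`** (`a, b ∈ ℂ`): the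
  `-4`-eigenspace of `(1 + J)^*` on `Alt⁴_ℝ(ℂ⁴; ℂ)` is the plane `⋀⁴ V_i^* ⊕ ⋀⁴ V_{-i}^*` spanned
  by `Ω = dz₀ ∧ dz₁ ∧ dz̄₂ ∧ dz̄₃` and `Ω̄`;
* `Weil.isConstOfType_two_two_of_apply_S`, `Weil.cconstClass_mem_hodgePQ_of_apply_S`: hence such
  `γ` are of type `(2, 2)` and their classes lie in `H^{2,2}(ℂ⁴/Φ(ℤ^ι))` for every period
  isomorphism `Φ` — Voisin's "`⋀⁴_K Γ_ℚ` is made of Hodge classes".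

## Proof

Slotwise `J`-weights. For a real `4`-linear complex-valued form `m` on `ℂ⁴` and a slot `j`, the
projections `P_j^± = ½ (1 ∓ i J_j)` (`Weil.proj`; `J_j` = `J` in slot `j`, `Weil.slot`; on `Weil.MultilinearForm4`) split `m`
into parts of `J`-weight `±i` in slot `j`; they commute with each other and with `(1 + J)^*`, and
`m = ∑_{ε ∈ {±}⁴} m^ε`, `m^ε = P_0^{ε₀} ⋯ P_3^{ε₃} m` (`Weil.comp4`, `Weil.sum_comp4`), with
`(1 + J)^* m^ε = ∏_j (1 + ε_j i) · m^ε` (`Weil.comp4_apply_S`). The products `∏_j (1 + ε_j i)` equal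
`-4` exactly for the two constant `ε` (`Weil.mu_ne`), so on the `-4`-eigenspace `m = m⁺ + m⁻`
(`Weil.eq_comp4_add_comp4`). Alternating both sides (`4! γ = A⁺ + A⁻`, `Weil.alternatization_self`;
alternation keeps a common slot weight, `Weil.alternatization_slotEigen`) reduces to: an
ALTERNATING form `A` of `J`-weight `i` in every slot is `A(e₀, …, e₃) · Ω` (`Weil.apply_eq_mul_Omega`)
— expand along `v_j = ∑_a v_{ja} e_a`, pull the coefficients out of the slots through the character
`χ_a(c) = Re c + Im c · jsign_a` (`= c` on `ℂ²_i`, `= c̄` on `ℂ²_{-i}`; `Weil.apply_update_single`),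
drop the non-injective index maps by alternation and compare with the same expansion of `Ω`
(`Weil.expansion`, `Weil.Omega_slotEigen`); weight `-i` reduces to weight `i` by complex
conjugation (`Weil.apply_eq_mul_conj_Omega`). Type `(2, 2)` of `a Ω + b Ω̄` is
`Weil.Omega_smul_exp`.

This is the de Rham half of clause (c) of the barrier fact
`Literature.Barriers.HodgeConjecture.Voisin2002_weilTorus_hodgeClassWithoutSubvarieties`
(programme in `Literature/Barriers/HodgeConjecture/KaehlerCoherentSheavesProofs.lean`): on a torus
of Weil type, a rational class in `ker((1 + I)^* + 4) ⊆ H⁴(X; ℂ)` is automatically of type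
`(2, 2)`. No named fact is introduced; the definitions (`slot`, `proj`, `comp4`, `mu`, `sg`,
`rsign`, `chi`) are explicit linear-algebra gadgets.

## References

* C. Voisin, IMRN 2002 no. 20, 1057–1075 (arXiv:math/0112247), §3 (pp. 5–6), Prop. 3.
  [Voisin2002KaehlerCounterexample]
* S. Zucker, Compositio Math. 34 (1977) 199–209, Appendix B, p. 208 (the eigenvalues of `J^*` on
  `⋀^{2n}`). [Zucker1977]
* B. van Geemen, in LNM 1594 (1994), Thm. 4.11 and §5 (Weil classes `⋀^{2n}_K H¹(X, ℚ)`).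
  [vanGeemen1994HodgeAV]
-/

noncomputable section

open scoped Manifold ContDiff Topology ComplexConjugate

universe u

namespace Literature.Geometry.Kaehler

open Literature.NumberTheory.Transcendental

namespace Weil

/-! ### `S⁴ = -4`: the quartic identity `(1 + J)^{*4} = 256` on `4`-forms -/

/-- `S² = 2J` (`(1 + J)² = 1 + 2J + J² = 2J`). [folklore] -/
theorem S_S (u : Fin 4 → ℂ) : S (S u) = (2 : ℂ) • J u := by
  funext a
  simp only [S_apply, Pi.smul_apply, J_apply, smul_eq_mul]
  have h := jsign_mul_self a
  linear_combination (u a) * h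

/-- `S⁴ = -4` (`(2J)² = 4J² = -4`). [folklore] -/
theorem S_S_S_S (u : Fin 4 → ℂ) : S (S (S (S u))) = (-4 : ℂ) • u := by
  rw [S_S, S_S, map_smul, J_J, smul_smul, smul_neg, ← neg_smul]
  norm_num

/-- **`((1 + J)^*)⁴ = 256` on `4`-forms**: for every continuous alternating real `4`-form `γ` on
`ℂ⁴`, `γ(S⁴v₀, …, S⁴v₃) = (-4)⁴ γ(v₀, …, v₃) = 256 γ(v)`. Hence the pull-back `T = (1 + I)^*` on
`H⁴` of a torus of Weil type satisfies `T⁴ = 256`, i.e. `(T + 4)(T - 4)(T² + 16) = 0`: its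
spectrum is `{(1+i)^m (1-i)^{4-m}} = {-4, -4i, 4, 4i}` (Voisin (2002), §3; cf. Zucker (1977),
App. B p. 208, the eigenvalues of `J^*`). [cite: Voisin2002KaehlerCounterexample, §3 pp. 5–6] -/
theorem apply_S_S_S_S (γ : (Fin 4 → ℂ) [⋀^Fin 4]→L[ℝ] ℂ) (v : Fin 4 → (Fin 4 → ℂ)) :
    γ (fun i ↦ S (S (S (S (v i))))) = 256 * γ v := by
  have h : (fun i ↦ S (S (S (S (v i))))) = fun i ↦ ((-4 : ℝ) : ℂ) • v i := by
    funext i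
    rw [S_S_S_S]
    norm_num
  rw [h]
  have h2 := γ.toContinuousMultilinearMap.toMultilinearMap.map_smul_univ (fun _ ↦ (-4 : ℝ)) v
  simp only [Complex.coe_smul] at h2 ⊢
  change γ (fun i ↦ (-4 : ℝ) • v i) = 256 * γ v
  change γ (fun i ↦ (-4 : ℝ) • v i) = (∏ _i : Fin 4, (-4 : ℝ)) • γ v at h2
  rw [h2, Fin.prod_const, Complex.real_smul]
  norm_num

/-- `((1 + J)^*)⁴ = 256` as an identity of operators on `4`-forms (`T ↦ γ ∘ S` iterated four
times). [cite: Voisin2002KaehlerCounterexample, §3 pp. 5–6] -/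
theorem compContinuousLinearMap_S_four (γ : (Fin 4 → ℂ) [⋀^Fin 4]→L[ℝ] ℂ) :
    (((γ.compContinuousLinearMap (S.restrictScalars ℝ)).compContinuousLinearMap
      (S.restrictScalars ℝ)).compContinuousLinearMap (S.restrictScalars ℝ)).compContinuousLinearMap
      (S.restrictScalars ℝ) = (256 : ℂ) • γ := by
  ext v
  simp only [ContinuousAlternatingMap.compContinuousLinearMap_apply,
    ContinuousAlternatingMap.smul_apply, smul_eq_mul, Function.comp_def,
    ContinuousLinearMap.coe_restrictScalars']
  exact apply_S_S_S_S γ v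

/-! ### Slot operators on real-multilinear complex-valued `4`-forms -/

section Slots

/-- The real `4`-linear complex-valued forms on `ℂ⁴` (not necessarily alternating), a
`ℂ`-module through the values. [folklore] -/
abbrev MultilinearForm4 : Type :=
  ContinuousMultilinearMap ℝ (fun _ : Fin 4 ↦ (Fin 4 → ℂ)) ℂ

/-- **Apply the real-linear map `A` in slot `j` only**: `(slot j A m)(v) = m(v₀, …, A v_j, …, v₃)`,
a `ℂ`-linear operator on real `4`-linear complex-valued forms. [folklore] -/
def slot (j : Fin 4) (A : (Fin 4 → ℂ) →L[ℝ] (Fin 4 → ℂ)) : MultilinearForm4 →ₗ[ℂ] MultilinearForm4 where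
  toFun m := m.compContinuousLinearMap
    (Function.update (fun _ : Fin 4 ↦ ContinuousLinearMap.id ℝ (Fin 4 → ℂ)) j A)
  map_add' m m' := by ext v; rfl
  map_smul' c m := by ext v; rfl

/-- `(slot j A m)(v) = m(update v j (A v_j))`. [folklore] -/
theorem slot_apply (j : Fin 4) (A : (Fin 4 → ℂ) →L[ℝ] (Fin 4 → ℂ)) (m : MultilinearForm4)
    (v : Fin 4 → (Fin 4 → ℂ)) : slot j A m v = m (Function.update v j (A (v j))) := by
  simp only [slot, LinearMap.coe_mk, AddHom.coe_mk,
    ContinuousMultilinearMap.compContinuousLinearMap_apply]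
  congr 1
  funext i
  by_cases h : i = j
  · subst h
    simp
  · simp [Function.update_of_ne h]

/-- **The slot projection** `P_j^ε = ½ (1 - ε i J_j)` (`ε = ±1`): the projection of a real
`4`-linear form onto its part of `J`-weight `ε i` in slot `j` (for a real-linear `f : V → ℂ` and
`J² = -1`, `f = f⁺ + f⁻` with `f^±(v) = ½ (f(v) ∓ i f(Jv))`, `f^±(Jv) = ± i f^±(v)`).
[folklore] -/
def proj (j : Fin 4) (ε : ℂ) : MultilinearForm4 →ₗ[ℂ] MultilinearForm4 :=
  (2⁻¹ : ℂ) • (LinearMap.id - (ε * Complex.I) • slot j (J.restrictScalars ℝ))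

/-- `(P_j^ε m)(v) = ½ (m(v) - ε i · m(update v j (J v_j)))`. [folklore] -/
theorem proj_apply (j : Fin 4) (ε : ℂ) (m : MultilinearForm4) (v : Fin 4 → (Fin 4 → ℂ)) :
    proj j ε m v = 2⁻¹ * (m v - ε * Complex.I * m (Function.update v j (J (v j)))) := by
  simp only [proj, LinearMap.smul_apply, LinearMap.sub_apply, LinearMap.id_apply,
    smul_apply, sub_apply, slot_apply, ContinuousLinearMap.coe_restrictScalars', smul_eq_mul]

/-- `P_j^{+} + P_j^{-} = 1`. [folklore] -/
theorem proj_one_add_proj_neg_one (j : Fin 4) (m : MultilinearForm4) : proj j 1 m + proj j (-1) m = m := by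
  ext v
  simp only [add_apply, proj_apply]
  ring

/-- **`P_j^ε m` has `J`-weight `ε i` in slot `j`** (`ε² = 1`). [folklore] -/
theorem proj_eigen (j : Fin 4) {ε : ℂ} (hε : ε * ε = 1) (m : MultilinearForm4) (v : Fin 4 → (Fin 4 → ℂ)) :
    proj j ε m (Function.update v j (J (v j))) = ε * Complex.I * proj j ε m v := by
  simp only [proj_apply, Function.update_idem, Function.update_self, J_J]
  have h : m (Function.update v j (-v j)) = -m v := by
    rw [← neg_one_smul ℝ (v j), m.map_update_smul, Function.update_eq_self, neg_one_smul]
  rw [h]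
  linear_combination (2⁻¹ * Complex.I ^ 2 * m (Function.update v j (J (v j)))) * hε +
    (2⁻¹ * m (Function.update v j (J (v j)))) * Complex.I_sq

/-- A slot projection in another slot preserves the `J`-weight in slot `j`. [folklore] -/
theorem proj_preserves {j l : Fin 4} (hlj : l ≠ j) (ε' : ℂ) {c : ℂ} {n : MultilinearForm4}
    (h : ∀ v, n (Function.update v j (J (v j))) = c * n v) (v : Fin 4 → (Fin 4 → ℂ)) :
    proj l ε' n (Function.update v j (J (v j))) = c * proj l ε' n v := by
  simp only [proj_apply]
  rw [Function.update_of_ne hlj, Function.update_comm hlj.symm, h v]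
  have h2 := h (Function.update v l (J (v l)))
  rw [Function.update_of_ne hlj.symm] at h2
  rw [h2]
  ring

/-- A form of `J`-weight `c` in slot `j` has `(1 + J)`-weight `1 + c` there. [folklore] -/
theorem apply_update_S {j : Fin 4} {c : ℂ} {n : MultilinearForm4}
    (h : ∀ v, n (Function.update v j (J (v j))) = c * n v) (v : Fin 4 → (Fin 4 → ℂ)) :
    n (Function.update v j (S (v j))) = (1 + c) * n v := by
  rw [S_apply', n.map_update_add, Function.update_eq_self, h v]
  ring

/-- **A form with `J`-weights `c_j` in all four slots is a `(1 + J)^*`-eigenvector with eigenvalue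
`∏_j (1 + c_j)`.** [folklore] -/
theorem apply_S_of_slotEigen {c : Fin 4 → ℂ} {n : MultilinearForm4}
    (h : ∀ j v, n (Function.update v j (J (v j))) = c j * n v) (v : Fin 4 → (Fin 4 → ℂ)) :
    n (fun i ↦ S (v i)) = (∏ j, (1 + c j)) * n v := by
  set w0 := Function.update v 0 (S (v 0)) with hw0
  set w1 := Function.update w0 1 (S (v 1)) with hw1
  set w2 := Function.update w1 2 (S (v 2)) with hw2
  set w3 := Function.update w2 3 (S (v 3)) with hw3
  have hv : (fun i ↦ S (v i)) = w3 := by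
    funext i
    fin_cases i <;> simp [w3, w2, w1, w0]
  have e1 : v 1 = w0 1 := by simp [w0]
  have e2 : v 2 = w1 2 := by simp [w1, w0]
  have e3 : v 3 = w2 3 := by simp [w2, w1, w0]
  rw [hv, hw3, e3, apply_update_S (h 3), hw2, e2, apply_update_S (h 2), hw1, e1,
    apply_update_S (h 1), hw0, apply_update_S (h 0), Fin.prod_univ_four]
  ring

/-- `S ∘ J = J ∘ S`. [folklore] -/
theorem S_J (u : Fin 4 → ℂ) : S (J u) = J (S u) := by
  funext a
  simp only [S_apply, J_apply]
  ring

/-- **The slot projections commute with `(1 + J)^*`** (because `S` and `J` commute). [folklore] -/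
theorem proj_compContinuousLinearMap_S (j : Fin 4) (ε : ℂ) (m : MultilinearForm4) :
    proj j ε (m.compContinuousLinearMap fun _ ↦ S.restrictScalars ℝ) =
      (proj j ε m).compContinuousLinearMap fun _ ↦ S.restrictScalars ℝ := by
  ext v
  simp only [proj_apply, ContinuousMultilinearMap.compContinuousLinearMap_apply,
    ContinuousLinearMap.coe_restrictScalars']
  congr 2
  · congr 1
    change m (fun i ↦ S (Function.update v j (J (v j)) i)) =
      m (Function.update (fun i ↦ S (v i)) j (J (S (v j))))
    congr 1
    rw [← S_J]
    exact Function.comp_update (f := fun x ↦ S x) v j (J (v j)) ▸ rfl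

end Slots

/-! ### The sixteen slotwise components `P_0^{ε₀} P_1^{ε₁} P_2^{ε₂} P_3^{ε₃} m` -/

section Components

/-- The sign `±1 ∈ ℂ` attached to a Boolean. [folklore] -/
def sg (b : Bool) : ℂ := if b then 1 else -1

/-- `sg true = 1`. [folklore] -/
@[simp] theorem sg_true : sg true = 1 := rfl

/-- `sg false = -1`. [folklore] -/
@[simp] theorem sg_false : sg false = -1 := rfl

/-- `sg b² = 1`. [folklore] -/
theorem sg_mul_self (b : Bool) : sg b * sg b = 1 := by
  cases b <;> simp

/-- **The slotwise component** `m^{ε} = P_0^{ε₀} P_1^{ε₁} P_2^{ε₂} P_3^{ε₃} m` of a real `4`-linear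
complex-valued form, `ε ∈ {±1}⁴`: its part of `J`-weight `ε_j i` in slot `j` for every `j`
(the summand `Λ^{a}(V_i^*) ⊗ Λ^{b}(V_{-i}^*)`-type component in coordinates). [folklore] -/
def comp4 (ε : Fin 4 → Bool) : MultilinearForm4 →ₗ[ℂ] MultilinearForm4 :=
  proj 0 (sg (ε 0)) ∘ₗ proj 1 (sg (ε 1)) ∘ₗ proj 2 (sg (ε 2)) ∘ₗ proj 3 (sg (ε 3))

/-- Unfolding of `comp4`. [folklore] -/
theorem comp4_apply (ε : Fin 4 → Bool) (m : MultilinearForm4) :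
    comp4 ε m = proj 0 (sg (ε 0)) (proj 1 (sg (ε 1)) (proj 2 (sg (ε 2)) (proj 3 (sg (ε 3)) m))) :=
  rfl

/-- **`m^ε` has `J`-weight `ε_j i` in every slot `j`.** [folklore] -/
theorem comp4_slotEigen (ε : Fin 4 → Bool) (m : MultilinearForm4) (j : Fin 4) (v : Fin 4 → (Fin 4 → ℂ)) :
    comp4 ε m (Function.update v j (J (v j))) = sg (ε j) * Complex.I * comp4 ε m v := by
  rw [comp4_apply]
  have h3 : ∀ v, proj 3 (sg (ε 3)) m (Function.update v 3 (J (v 3))) =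
      sg (ε 3) * Complex.I * proj 3 (sg (ε 3)) m v := proj_eigen 3 (sg_mul_self _) m
  fin_cases j
  · exact proj_eigen 0 (sg_mul_self _) _ v
  · exact proj_preserves (by decide) _ (proj_eigen 1 (sg_mul_self _) _) v
  · exact proj_preserves (by decide) _ (proj_preserves (by decide) _
      (proj_eigen 2 (sg_mul_self _) _)) v
  · exact proj_preserves (by decide) _ (proj_preserves (by decide) _
      (proj_preserves (by decide) _ h3)) v

/-- The `(1 + J)^*`-eigenvalue `μ_ε = ∏_j (1 + ε_j i) ∈ {(1+i)^a (1-i)^{4-a}}` of the component `m^ε`.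
[cite: Voisin2002KaehlerCounterexample, §3 pp. 5–6] -/
def mu (ε : Fin 4 → Bool) : ℂ := ∏ j, (1 + sg (ε j) * Complex.I)

/-- **`(1 + J)^* m^ε = μ_ε m^ε`.** [cite: Voisin2002KaehlerCounterexample, §3 pp. 5–6] -/
theorem comp4_apply_S (ε : Fin 4 → Bool) (m : MultilinearForm4) (v : Fin 4 → (Fin 4 → ℂ)) :
    comp4 ε m (fun i ↦ S (v i)) = mu ε * comp4 ε m v :=
  apply_S_of_slotEigen (c := fun j ↦ sg (ε j) * Complex.I) (fun j v ↦ comp4_slotEigen ε m j v) v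

/-- The components commute with `(1 + J)^*`. [folklore] -/
theorem comp4_compContinuousLinearMap_S (ε : Fin 4 → Bool) (m : MultilinearForm4) :
    comp4 ε (m.compContinuousLinearMap fun _ ↦ S.restrictScalars ℝ) =
      (comp4 ε m).compContinuousLinearMap fun _ ↦ S.restrictScalars ℝ := by
  simp only [comp4_apply, proj_compContinuousLinearMap_S]

/-- **The sixteen components sum to the form**: `m = ∑_{ε ∈ {±1}⁴} m^ε` (from `P_j⁺ + P_j⁻ = 1`
in each slot). [folklore] -/
theorem sum_comp4 (m : MultilinearForm4) :
    ∑ a : Bool, ∑ b : Bool, ∑ c : Bool, ∑ d : Bool, comp4 ![a, b, c, d] m = m := by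
  have key : ∀ (j : Fin 4) (n : MultilinearForm4), ∑ b : Bool, proj j (sg b) n = n := fun j n ↦ by
    rw [Fintype.sum_bool, sg_true, sg_false, proj_one_add_proj_neg_one]
  simp only [comp4_apply, Matrix.cons_val_zero, Matrix.cons_val_one, Matrix.cons_val]
  have h3 : ∀ a b c : Bool, ∑ d : Bool, proj 0 (sg a) (proj 1 (sg b) (proj 2 (sg c) (proj 3 (sg d) m)))
      = proj 0 (sg a) (proj 1 (sg b) (proj 2 (sg c) m)) := fun a b c ↦ by
    rw [← key 3 m, map_sum, map_sum, map_sum, key 3 m]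
  simp only [h3]
  have h2 : ∀ a b : Bool, ∑ c : Bool, proj 0 (sg a) (proj 1 (sg b) (proj 2 (sg c) m))
      = proj 0 (sg a) (proj 1 (sg b) m) := fun a b ↦ by
    rw [← key 2 m, map_sum, map_sum, key 2 m]
  simp only [h2]
  have h1 : ∀ a : Bool, ∑ b : Bool, proj 0 (sg a) (proj 1 (sg b) m) = proj 0 (sg a) m := fun a ↦ by
    rw [← key 1 m, map_sum, key 1 m]
  simp only [h1]
  exact key 0 m

/-- `μ_ε = -4` only for the two constant sign vectors `ε = (+,+,+,+)`, `(-,-,-,-)` (the other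
eigenvalues are `4` and `±4i`). [cite: Voisin2002KaehlerCounterexample, §3 pp. 5–6] -/
theorem mu_ne (a b c d : Bool) (h : ¬ (a = b ∧ b = c ∧ c = d)) : mu ![a, b, c, d] + 4 ≠ 0 := by
  simp only [mu, Fin.prod_univ_four, Matrix.cons_val_zero, Matrix.cons_val_one, Matrix.cons_val]
  cases a <;> cases b <;> cases c <;> cases d <;> simp at h <;>
    simp [sg, Complex.ext_iff, Complex.mul_re, Complex.mul_im, Complex.add_re, Complex.add_im] <;>
    norm_num

/-- **On the `-4`-eigenspace of `(1 + J)^*` only the two constant components survive**: if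
`m ∘ S = -4 m` then `m^ε = 0` for every non-constant `ε`. [cite: Voisin2002KaehlerCounterexample, §3 pp. 5–6] -/
theorem comp4_eq_zero_of_apply_S {m : MultilinearForm4} (hm : ∀ v, m (fun i ↦ S (v i)) = -4 * m v)
    (a b c d : Bool) (h : ¬ (a = b ∧ b = c ∧ c = d)) : comp4 ![a, b, c, d] m = 0 := by
  have hmS : (m.compContinuousLinearMap fun _ ↦ S.restrictScalars ℝ) = (-4 : ℂ) • m := by
    ext v
    simp only [ContinuousMultilinearMap.compContinuousLinearMap_apply,
      ContinuousLinearMap.coe_restrictScalars', smul_apply, smul_eq_mul]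
    exact hm v
  ext v
  have h1 := comp4_apply_S ![a, b, c, d] m v
  have h2 : comp4 ![a, b, c, d] m (fun i ↦ S (v i)) = -4 * comp4 ![a, b, c, d] m v := by
    have := congrArg (fun n : MultilinearForm4 ↦ n v) (comp4_compContinuousLinearMap_S ![a, b, c, d] m)
    simp only [ContinuousMultilinearMap.compContinuousLinearMap_apply,
      ContinuousLinearMap.coe_restrictScalars', hmS, map_smul, smul_apply, smul_eq_mul] at this
    exact this.symm
  have h3 : (mu ![a, b, c, d] + 4) * comp4 ![a, b, c, d] m v = 0 := by
    linear_combination h1.symm.trans h2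
  simpa [mu_ne a b c d h] using h3

/-- **`m = m⁺ + m⁻` on the `-4`-eigenspace of `(1 + J)^*`**, with `m^± = P_0^± P_1^± P_2^± P_3^± m`
of `J`-weight `±i` in every slot (in coordinates: `ker((1+I)^* + 4) = ⋀⁴ V_i^* ⊕ ⋀⁴ V_{-i}^*`,
Voisin (2002), §3). [cite: Voisin2002KaehlerCounterexample, §3 pp. 5–6] -/
theorem eq_comp4_add_comp4 {m : MultilinearForm4} (hm : ∀ v, m (fun i ↦ S (v i)) = -4 * m v) :
    m = comp4 ![true, true, true, true] m + comp4 ![false, false, false, false] m := by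
  have hz : ∀ a b c d : Bool, comp4 ![a, b, c, d] m =
      if (a = b ∧ b = c ∧ c = d) then comp4 ![a, b, c, d] m else 0 := fun a b c d ↦ by
    split_ifs with h
    · rfl
    · exact comp4_eq_zero_of_apply_S hm a b c d h
  conv_lhs => rw [← sum_comp4 m]
  simp only [Fintype.sum_bool]
  rw [hz true true true false, hz true true false true, hz true true false false,
    hz true false true true, hz true false true false, hz true false false true,
    hz true false false false, hz false true true true, hz false true true false,
    hz false true false true, hz false true false false, hz false false true true,
    hz false false true false, hz false false false true]
  simp

end Components

/-! ### Alternating forms with `J`-weight `i` in every slot are multiples of `Ω` -/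

section Expansion

/-- The alternation of an alternating `4`-form is `4! = 24` times the form. [folklore] -/
theorem alternatization_self (γ : (Fin 4 → ℂ) [⋀^Fin 4]→L[ℝ] ℂ) (v : Fin 4 → (Fin 4 → ℂ)) :
    ContinuousMultilinearMap.alternatization γ.toContinuousMultilinearMap v = 24 * γ v := by
  rw [ContinuousMultilinearMap.alternatization_apply_apply]
  have h : ∀ σ : Equiv.Perm (Fin 4),
      Equiv.Perm.sign σ • γ.toContinuousMultilinearMap (v ∘ σ) = γ v := fun σ ↦ by
    change Equiv.Perm.sign σ • γ.toAlternatingMap (v ∘ σ) = γ v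
    rw [γ.toAlternatingMap.map_perm v σ, smul_smul, Int.units_mul_self, one_smul]
    rfl
  simp only [h, Finset.sum_const, Finset.card_univ, Fintype.card_perm, Fintype.card_fin,
    nsmul_eq_mul]
  norm_num [Nat.factorial]

/-- **Alternation preserves a common slot weight**: if `n` has `J`-weight `c` in every slot, so
does its alternation. [folklore] -/
theorem alternatization_slotEigen {n : MultilinearForm4} {c : ℂ}
    (h : ∀ j v, n (Function.update v j (J (v j))) = c * n v) (j : Fin 4)
    (v : Fin 4 → (Fin 4 → ℂ)) :
    ContinuousMultilinearMap.alternatization n (Function.update v j (J (v j))) =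
      c * ContinuousMultilinearMap.alternatization n v := by
  simp only [ContinuousMultilinearMap.alternatization_apply_apply]
  rw [Finset.mul_sum]
  refine Finset.sum_congr rfl fun σ _ ↦ ?_
  rw [Function.update_comp_equiv]
  have hσ := h (σ.symm j) (v ∘ σ)
  simp only [Function.comp_apply, Equiv.apply_symm_apply] at hσ
  rw [hσ]
  simp only [Units.smul_def, zsmul_eq_mul]
  ring

/-- `OmegaAux` has `J`-weight `i` in every slot (`i z₀ · z₁ · z̄₂ · z̄₃ = …`,
`\overline{-i z₂} = i z̄₂`). [folklore] -/
theorem OmegaAux_slotEigen (j : Fin 4) (w : Fin 4 → (Fin 4 → ℂ)) :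
    OmegaAux (Function.update w j (J (w j))) = Complex.I * OmegaAux w := by
  have hj4 : j = 0 ∨ j = 1 ∨ j = 2 ∨ j = 3 := by fin_cases j <;> decide
  rw [OmegaAux_apply, OmegaAux_apply]
  rcases hj4 with rfl | rfl | rfl | rfl
  · simp
    ring
  · simp
    ring
  · simp
    ring
  · simp
    ring

/-- **The Weil form has `J`-weight `i` in every slot.** [cite: Voisin2002KaehlerCounterexample, §3 pp. 5–6] -/
theorem Omega_slotEigen (j : Fin 4) (v : Fin 4 → (Fin 4 → ℂ)) :
    Omega (Function.update v j (J (v j))) = Complex.I * Omega v :=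
  alternatization_slotEigen (n := OmegaAux) (fun j w ↦ OmegaAux_slotEigen j w) j v

/-- The real sign pattern `(1, 1, -1, -1)`: `jsign a = rsign a · i`. [folklore] -/
def rsign : Fin 4 → ℝ := ![1, 1, -1, -1]

/-- `rsign a · i = jsign a`. [folklore] -/
theorem rsign_mul_I (a : Fin 4) : (rsign a : ℂ) * Complex.I = jsign a := by
  fin_cases a <;> simp [rsign, jsign]

/-- `rsign a² = 1`. [folklore] -/
theorem rsign_mul_self (a : Fin 4) : rsign a * rsign a = 1 := by
  fin_cases a <;> simp [rsign]

/-- `J e_a = rsign a · (i e_a)` on the standard vectors `e_a = (δ_{ab})_b`. [folklore] -/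
theorem J_single_one (a : Fin 4) :
    J (Pi.single a (1 : ℂ)) = (rsign a : ℝ) • (Pi.single a Complex.I : Fin 4 → ℂ) := by
  funext b
  by_cases hb : b = a
  · subst hb
    simp only [J_apply, Pi.single_eq_same, mul_one, Pi.smul_apply, Complex.real_smul,
      rsign_mul_I]
  · simp [Pi.single_eq_of_ne hb]

/-- The **slot character** `χ_a(c) = Re c + Im c · jsign_a`: `χ_a(c) = c` for `a ∈ {0, 1}` and
`χ_a(c) = c̄` for `a ∈ {2, 3}` — how a complex coefficient on `e_a` leaves a slot of `J`-weight `i`.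
[folklore] -/
def chi (a : Fin 4) (c : ℂ) : ℂ := (c.re : ℂ) + (c.im : ℂ) * jsign a

/-- Decomposition of `c e_a` along `e_a` and `i e_a` with real coefficients. [folklore] -/
theorem single_eq_smul_add_smul (a : Fin 4) (c : ℂ) :
    (Pi.single a c : Fin 4 → ℂ) =
      (c.re : ℝ) • (Pi.single a (1 : ℂ) : Fin 4 → ℂ) + (c.im : ℝ) • (Pi.single a Complex.I : Fin 4 → ℂ) := by
  funext b
  by_cases hb : b = a
  · subst hb
    simp only [Pi.single_eq_same, Pi.add_apply, Pi.smul_apply, Complex.real_smul, mul_one]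
    exact (Complex.re_add_im c).symm
  · simp [Pi.single_eq_of_ne hb]

variable {n : MultilinearForm4} (h : ∀ j v, n (Function.update v j (J (v j))) = Complex.I * n v)
include h

/-- In a slot of `J`-weight `i`: `n(…, i e_a, …) = jsign_a · n(…, e_a, …)`. [folklore] -/
theorem apply_update_single_I (w : Fin 4 → (Fin 4 → ℂ)) (j a : Fin 4) :
    n (Function.update w j (Pi.single a Complex.I)) =
      jsign a * n (Function.update w j (Pi.single a 1)) := by
  have h1 := h j (Function.update w j (Pi.single a 1))
  simp only [Function.update_self, Function.update_idem, J_single_one, n.map_update_smul,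
    Complex.real_smul] at h1
  have h2 := congrArg (fun z ↦ (rsign a : ℂ) * z) h1
  simp only [← mul_assoc] at h2
  rw [← Complex.ofReal_mul, rsign_mul_self, Complex.ofReal_one, one_mul, rsign_mul_I] at h2
  exact h2

/-- In a slot of `J`-weight `i`: `n(…, c e_a, …) = χ_a(c) · n(…, e_a, …)`. [folklore] -/
theorem apply_update_single (w : Fin 4 → (Fin 4 → ℂ)) (j a : Fin 4) (c : ℂ) :
    n (Function.update w j (Pi.single a c)) = chi a c * n (Function.update w j (Pi.single a 1)) := by
  rw [single_eq_smul_add_smul, n.map_update_add, n.map_update_smul, n.map_update_smul,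
    apply_update_single_I h, chi, Complex.real_smul, Complex.real_smul]
  ring

/-- All four slots at once: `n(c₀ e_{f 0}, …, c₃ e_{f 3}) = (∏_j χ_{f j}(c_j)) · n(e_{f 0}, …, e_{f 3})`.
[folklore] -/
theorem apply_single_eq_prod_mul (f : Fin 4 → Fin 4) (c : Fin 4 → ℂ) :
    n (fun j ↦ Pi.single (f j) (c j)) = (∏ j, chi (f j) (c j)) * n (fun j ↦ Pi.single (f j) 1) := by
  have step : ∀ (w : Fin 4 → (Fin 4 → ℂ)) (j : Fin 4), w j = Pi.single (f j) (c j) →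
      n w = chi (f j) (c j) * n (Function.update w j (Pi.single (f j) 1)) := fun w j hw ↦ by
    calc n w = n (Function.update w j (w j)) := by rw [Function.update_eq_self]
      _ = n (Function.update w j (Pi.single (f j) (c j))) := by rw [hw]
      _ = _ := apply_update_single h w j (f j) (c j)
  set V0 : Fin 4 → (Fin 4 → ℂ) := fun j ↦ Pi.single (f j) (c j) with hV0
  set V1 := Function.update V0 0 (Pi.single (f 0) (1 : ℂ)) with hV1
  set V2 := Function.update V1 1 (Pi.single (f 1) (1 : ℂ)) with hV2
  set V3 := Function.update V2 2 (Pi.single (f 2) (1 : ℂ)) with hV3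
  set V4 := Function.update V3 3 (Pi.single (f 3) (1 : ℂ)) with hV4
  have e0 : V0 0 = Pi.single (f 0) (c 0) := rfl
  have e1 : V1 1 = Pi.single (f 1) (c 1) := by simp [V1, V0]
  have e2 : V2 2 = Pi.single (f 2) (c 2) := by simp [V2, V1, V0]
  have e3 : V3 3 = Pi.single (f 3) (c 3) := by simp [V3, V2, V1, V0]
  have hlast : V4 = fun j ↦ Pi.single (f j) 1 := by
    funext j
    fin_cases j <;> simp [V4, V3, V2, V1, V0]
  rw [step V0 0 e0, ← hV1, step V1 1 e1, ← hV2, step V2 2 e2, ← hV3, step V3 3 e3, ← hV4, hlast,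
    Fin.prod_univ_four]
  ring

omit h in
/-- **Expansion of an alternating form of `J`-weight `i` in every slot** along the standard vectors:
`A(v) = (∑_σ sgn σ ∏_j χ_{σ j}(v_{j, σ j})) · A(e₀, e₁, e₂, e₃)` — non-injective index maps drop
out by alternation. [folklore] -/
theorem expansion (A : (Fin 4 → ℂ) [⋀^Fin 4]→L[ℝ] ℂ)
    (hA : ∀ j v, A (Function.update v j (J (v j))) = Complex.I * A v)
    (v : Fin 4 → (Fin 4 → ℂ)) :
    A v = (∑ σ : Equiv.Perm (Fin 4), ((Equiv.Perm.sign σ : ℤ) : ℂ) *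
      ∏ j, chi (σ j) (v j (σ j))) * A (fun a ↦ Pi.single a 1) := by
  classical
  have hv : v = fun j ↦ ∑ a, Pi.single a (v j a) := by
    funext j
    exact (Finset.univ_sum_single (v j)).symm
  have hsum : A v = ∑ f : Fin 4 → Fin 4, A (fun j ↦ Pi.single (f j) (v j (f j))) := by
    conv_lhs => rw [hv]
    exact A.toContinuousMultilinearMap.toMultilinearMap.map_sum (fun j a ↦ Pi.single a (v j a))
  have hterm : ∀ f : Fin 4 → Fin 4, A (fun j ↦ Pi.single (f j) (v j (f j))) =
      (∏ j, chi (f j) (v j (f j))) * A (fun j ↦ Pi.single (f j) 1) := fun f ↦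
    apply_single_eq_prod_mul (n := A.toContinuousMultilinearMap) hA f (fun j ↦ v j (f j))
  have hzero : ∀ f : Fin 4 → Fin 4, ¬ Function.Bijective f →
      (∏ j, chi (f j) (v j (f j))) * A (fun j ↦ Pi.single (f j) 1) = 0 := fun f hf ↦ by
    have hinj : ¬ Function.Injective f := fun hi ↦ hf (Finite.injective_iff_bijective.mp hi)
    rw [A.map_eq_zero_of_not_injective _ (fun hi ↦ hinj fun a b hab ↦ hi (by
      show (Pi.single (f a) (1 : ℂ) : Fin 4 → ℂ) = Pi.single (f b) 1
      rw [hab])), mul_zero]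
  have hperm : ∀ σ : Equiv.Perm (Fin 4), A (fun j ↦ Pi.single (σ j) (1 : ℂ)) =
      ((Equiv.Perm.sign σ : ℤ) : ℂ) * A (fun a ↦ Pi.single a 1) := fun σ ↦ by
    have hp := A.toAlternatingMap.map_perm (fun a ↦ (Pi.single a (1 : ℂ) : Fin 4 → ℂ)) σ
    simp only [Units.smul_def, zsmul_eq_mul] at hp
    exact hp
  rw [hsum]
  simp only [hterm]
  calc ∑ f : Fin 4 → Fin 4, (∏ j, chi (f j) (v j (f j))) * A (fun j ↦ Pi.single (f j) 1)
      = ∑ f ∈ (Finset.univ : Finset (Fin 4 → Fin 4)).filter Function.Bijective,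
          (∏ j, chi (f j) (v j (f j))) * A (fun j ↦ Pi.single (f j) 1) :=
        (Finset.sum_subset (Finset.filter_subset _ _) fun f _ hbij ↦ hzero f (by
          simpa only [true_and, Finset.mem_filter, Finset.mem_univ] using hbij)).symm
    _ = ∑ σ : Equiv.Perm (Fin 4), (∏ j, chi (σ j) (v j (σ j))) * A (fun j ↦ Pi.single (σ j) 1) :=
        Finset.sum_bij (fun p hp ↦ Equiv.ofBijective p (Finset.mem_filter.1 hp).2)
          (fun _ _ ↦ Finset.mem_univ _) (fun _ _ _ _ hh ↦ by injection hh)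
          (fun b _ ↦ ⟨b, Finset.mem_filter.2 ⟨Finset.mem_univ _, b.bijective⟩,
            Equiv.coe_fn_injective rfl⟩) fun _ _ ↦ rfl
    _ = (∑ σ : Equiv.Perm (Fin 4), ((Equiv.Perm.sign σ : ℤ) : ℂ) *
          ∏ j, chi (σ j) (v j (σ j))) * A (fun a ↦ Pi.single a 1) := by
        rw [Finset.sum_mul]
        refine Finset.sum_congr rfl fun σ _ ↦ ?_
        rw [hperm σ]
        ring

omit h in
/-- **An alternating `4`-form on `ℂ⁴` of `J`-weight `i` in every slot is a multiple of the Weil form**: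
`A = A(e₀, e₁, e₂, e₃) · Ω` (in coordinates: `⋀⁴ V_i^*` is the line spanned by
`dz₀ ∧ dz₁ ∧ dz̄₂ ∧ dz̄₃`, Voisin (2002), §3: "`⋀⁴ ℂ⁴_i = ⋀² W_i ⊗ ⋀² W̄_{-i}`").
[cite: Voisin2002KaehlerCounterexample, §3 pp. 5–6] -/
theorem apply_eq_mul_Omega (A : (Fin 4 → ℂ) [⋀^Fin 4]→L[ℝ] ℂ)
    (hA : ∀ j v, A (Function.update v j (J (v j))) = Complex.I * A v)
    (v : Fin 4 → (Fin 4 → ℂ)) : A v = A (fun a ↦ Pi.single a 1) * Omega v := by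
  have h1 := expansion A hA v
  have h2 := expansion Omega Omega_slotEigen v
  rw [Omega_basis, mul_one] at h2
  rw [h1, ← h2]
  ring

omit h in
/-- **An alternating `4`-form on `ℂ⁴` of `J`-weight `-i` in every slot is a multiple of `Ω̄`**:
`A = A(e₀, e₁, e₂, e₃) · \overline{Ω}` (`⋀⁴ V_{-i}^*` is spanned by `dz̄₀ ∧ dz̄₁ ∧ dz₂ ∧ dz₃ = \overline{Ω}`).
[cite: Voisin2002KaehlerCounterexample, §3 pp. 5–6] -/
theorem apply_eq_mul_conj_Omega (A : (Fin 4 → ℂ) [⋀^Fin 4]→L[ℝ] ℂ)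
    (hA : ∀ j v, A (Function.update v j (J (v j))) = -Complex.I * A v)
    (v : Fin 4 → (Fin 4 → ℂ)) : A v = A (fun a ↦ Pi.single a 1) * conj (Omega v) := by
  set B : (Fin 4 → ℂ) [⋀^Fin 4]→L[ℝ] ℂ :=
    (Complex.conjCLE.toContinuousLinearMap).compContinuousAlternatingMap A with hB
  have hBapply : ∀ w, B w = conj (A w) := fun w ↦ rfl
  have hB' : ∀ j v, B (Function.update v j (J (v j))) = Complex.I * B v := fun j v ↦ by
    rw [hBapply, hBapply, hA, map_mul, map_neg, Complex.conj_I, neg_neg]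
  have h1 := apply_eq_mul_Omega B hB' v
  rw [hBapply, hBapply] at h1
  have h2 := congrArg conj h1
  simpa [map_mul] using h2

end Expansion

/-! ### The `-4`-eigenspace of `(1 + J)^*` on `4`-forms: `span(Ω, Ω̄)`, of type `(2, 2)` -/

section Main

/-- **The `-4`-eigenvectors of `(1 + J)^*` among the alternating `4`-forms on `ℂ⁴` are exactly the
combinations `a Ω + b Ω̄`** (Voisin (2002), §3: under `H⁴(X, ℂ) = ⋀⁴ Γ_ℂ^*` the classes on which
`1 + I` acts by `(1 ± i)⁴ = -4` form `⋀⁴ (ℂ⁴_i)^* ⊕ ⋀⁴ (ℂ⁴_{-i})^*`, the complexification of the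
`2`-dimensional space `⋀⁴_K Γ_ℚ` of Weil classes). Proof: `γ = γ⁺ + γ⁻` with `γ^±` of `J`-weight
`±i` in every slot (`eq_comp4_add_comp4`), alternate (`24 γ = A⁺ + A⁻`), and expand
(`apply_eq_mul_Omega`, `apply_eq_mul_conj_Omega`). [cite: Voisin2002KaehlerCounterexample, §3 pp. 5–6] -/
theorem exists_eq_Omega_of_apply_S (γ : (Fin 4 → ℂ) [⋀^Fin 4]→L[ℝ] ℂ)
    (hγ : ∀ v, γ (fun i ↦ S (v i)) = -4 * γ v) :
    ∃ a b : ℂ, ∀ v, γ v = a * Omega v + b * conj (Omega v) := by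
  set m : MultilinearForm4 := γ.toContinuousMultilinearMap with hm
  have hmS : ∀ v, m (fun i ↦ S (v i)) = -4 * m v := hγ
  set Ap := ContinuousMultilinearMap.alternatization (comp4 ![true, true, true, true] m) with hAp
  set Am := ContinuousMultilinearMap.alternatization (comp4 ![false, false, false, false] m)
    with hAm
  have hdec : ∀ v, 24 * γ v = Ap v + Am v := fun v ↦ by
    rw [← alternatization_self γ v]
    change ContinuousMultilinearMap.alternatization m v = _
    conv_lhs => rw [eq_comp4_add_comp4 hmS]
    rw [map_add]
    rfl
  have hp : ∀ j v, Ap (Function.update v j (J (v j))) = Complex.I * Ap v := fun j v ↦ by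
    refine alternatization_slotEigen (fun j v ↦ ?_) j v
    rw [comp4_slotEigen]
    congr 1
    fin_cases j <;> simp
  have hn : ∀ j v, Am (Function.update v j (J (v j))) = -Complex.I * Am v := fun j v ↦ by
    refine alternatization_slotEigen (fun j v ↦ ?_) j v
    rw [comp4_slotEigen]
    congr 1
    fin_cases j <;> simp
  refine ⟨24⁻¹ * Ap (fun a ↦ Pi.single a 1), 24⁻¹ * Am (fun a ↦ Pi.single a 1), fun v ↦ ?_⟩
  have h1 := apply_eq_mul_Omega Ap hp v
  have h2 := apply_eq_mul_conj_Omega Am hn v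
  have h3 := hdec v
  rw [h1, h2] at h3
  linear_combination (24⁻¹ : ℂ) * h3

/-- **The `-4`-eigenvectors of `(1 + J)^*` among the alternating `4`-forms on `ℂ⁴` are of type
`(2, 2)`** — the coordinate form of Voisin's "`⋀⁴_K Γ_ℚ` is made of Hodge classes, that is, is
contained in the subspace `H^{2,2}(X)`" for a torus of Weil type `X = ℂ⁴/Γ` (on which `(1 + I)^*`
acts on `H⁴_dR(X; ℂ) = Alt⁴_ℝ(ℂ⁴; ℂ)` through `γ ↦ γ ∘ S`). [cite: Voisin2002KaehlerCounterexample, §3 pp. 5–6] -/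
theorem isConstOfType_two_two_of_apply_S (γ : (Fin 4 → ℂ) [⋀^Fin 4]→L[ℝ] ℂ)
    (hγ : ∀ v, γ (fun i ↦ S (v i)) = -4 * γ v) : ComplexTorus.IsConstOfType 2 2 γ := by
  obtain ⟨a, b, hab⟩ := exists_eq_Omega_of_apply_S γ hγ
  refine ⟨rfl, fun θ v ↦ ?_⟩
  rw [hab, hab v, Omega_smul_exp]
  norm_num

/-- The same, with the eigenvector hypothesis stated as an identity of forms
`γ ∘ (1 + J) = -4 γ`. [cite: Voisin2002KaehlerCounterexample, §3 pp. 5–6] -/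
theorem isConstOfType_two_two_of_compContinuousLinearMap_S (γ : (Fin 4 → ℂ) [⋀^Fin 4]→L[ℝ] ℂ)
    (hγ : γ.compContinuousLinearMap (S.restrictScalars ℝ) = (-4 : ℂ) • γ) :
    ComplexTorus.IsConstOfType 2 2 γ := by
  refine isConstOfType_two_two_of_apply_S γ fun v ↦ ?_
  have h := congrArg (fun δ : (Fin 4 → ℂ) [⋀^Fin 4]→L[ℝ] ℂ ↦ δ v) hγ
  simpa [ContinuousAlternatingMap.compContinuousLinearMap_apply, Function.comp_def] using h

/-- **On every complex torus `X = ℂ⁴/Φ(ℤ^ι)`, the class of an invariant `4`-form `γ` with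
`γ ∘ (1 + J) = -4 γ` lies in `H^{2,2}(X)`.** For a torus of Weil type (`J` preserving the lattice)
these are the classes on which the isogeny `1 + I` acts by `-4`, i.e. the complex span of the Weil
classes `⋀⁴_K Γ_ℚ` (Voisin (2002), §3). [cite: Voisin2002KaehlerCounterexample, §3 pp. 5–6] -/
theorem cconstClass_mem_hodgePQ_of_apply_S {ι : Type*} [Fintype ι]
    (Φ : (ι → ℝ) ≃L[ℝ] (Fin 4 → ℂ)) (γ : (Fin 4 → ℂ) [⋀^Fin 4]→L[ℝ] ℂ)
    (hγ : ∀ v, γ (fun i ↦ S (v i)) = -4 * γ v) :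
    ComplexTorus.cconstClass Φ γ ∈ hodgePQ (Fin 4 → ℂ) (ComplexTorus Φ) 4 2 2 :=
  ComplexTorus.cconstClass_mem_hodgePQ Φ (isConstOfType_two_two_of_apply_S γ hγ)

end Main


end Weil

end Literature.Geometry.Kaehler

end
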